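/-
Copyright (c) 2026 the pub-hodgecm-mathlib formalisation cell (harness21).  Prover seat hodgecm-mathlib-K2Liu-p10 (g5), Track B «K2-LIT»,
#184♮ = hLiu418 = `stmt-HodgeConjecture-24832`; (σ) endgame organ, the `hne` transport letter, FILE T1: the `Δ`-similitude `d_a = diag(1_Δ, a·1_∇)` and `Ad d_a` on `H_v`.
-/
import Literature.NumberTheory.K2Lit.LocalSiegelIntertwining                          -- ★ `unipDeltaLocal`, `mem_unipDeltaLocal_iff_blocks`; brings ★ D1 `localDegPS`, `IsSmooth`
import Literature.NumberTheory.GelbartRogawski1991.LocalDoubledUnitaryIwahori          -- ★ `matA_ofMat` currency, `isSiegelDelta_iff_blkC_eq_zero`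
import Literature.NumberTheory.GelbartRogawski1991.LocalKudlaSplittingInjective        -- ★ `matW_eq_matA_map`, `blkA_map`
import Literature.NumberTheory.GelbartRogawski1991.LocalDoubledUnitarySplitParabolic   -- ★ `detDelta_eq_det_blkA`
import Literature.NumberTheory.GelbartRogawski1991.DoubledUnitaryAdaptedRelations       -- ★ `adapt_conj`
import Literature.NumberTheory.Automorphic.LocalUnitaryGroupCongr                      -- ★ `localFormCongr`, `coe_localFormCongr_apply`
import Literature.NumberTheory.Automorphic.UnitaryGroupLocalCongr                      -- ★ `adelicForm_map_adeleToLocal`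
import HarnessLib

/-!
# Crux `HLiu418`, (σ) endgame, `hne` transport letter, FILE T1: THE `Δ`-SIMILITUDE `d_a` OF `𝔻 = Δ ⊕ ∇` AND `Ad d_a` ON `H_v = U(𝔻)(F_v)`

Cell `hodgecm-mathlib`, crux item hLiu418 = `stmt-HodgeConjecture-24832`, route of record `HCCMUnconditional`; squad K2 ∕ K2Liu, prover K2Liu-p10 (g5); organ lead
K2Liu-p09 (g7) (15:27:40Z: the `hne` witness of the face of record is transported between the two ternary spaces `V′` and `a • V′` along this similitude).
DEFINITIONS WITH BODIES (`similY`, `similMat`, `similGL`, `adDeltaSimil`) + theorems; no instance, no notation, no named fact, no `sorry`; definition lane,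
`--supports stmt-HodgeConjecture-24832 --as helper`.  ★ K2Lit generic currency `(F E c hcδ hδ hd v n hT₀ hJD)`.

For `a ∈ (F_v)ˣ` the matrix `d_a := diag(1_Δ, a·1_∇)` in the Lagrangian frame `(Δ, ∇)` of the doubled space `𝔻 = 𝕍 ⊕ (−𝕍)` is a SIMILITUDE of `J^𝔻` with multiplier `a`
(`Δ, ∇` are isotropic and paired by `J^𝔻`); conjugation by it is a topological automorphism of `H_v = U(𝔻)(F_v)` preserving the Siegel parabolic:
* §1 the matrices: `similY a = fromBlocks 1 0 0 (a•1)` (adapted frame), `similMat a = R · similY a · R⁻¹` (matrix frame), `similGL a ∈ GL_{2n}(E ⊗ F_v)`; multiplicativity,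
  determinant, and **`formCongr conjLocal (similGL a) J^𝔻_v = a • J^𝔻_v`** (`cstar_similMat_mul_diag_mul`).
* §2 **`adDeltaSimil a : H_v ≃ₜ* H_v`**, `g ↦ d_a g d_a⁻¹` (★ `localFormCongr` between the ★ `localPiEquiv` models); its block action
  **`A ↦ A`, `B ↦ a⁻¹ B`, `C ↦ a C`, `D ↦ D`** (`blkA∕blkB∕blkC∕blkD_matA_adDeltaSimil`).
* §3 invariances: `IsSiegelDelta`, `unipDeltaLocal`, `detDelta`, `absDetDelta`, `chiDet`, `localSiegelCharacter`; hence **`isLocalSiegelSection_comp_adDeltaSimil`**,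
  **`isSmooth_comp_adDeltaSimil`**, **`comp_adDeltaSimil_mem_localDegPS`** (`f ↦ f ∘ Ad d_a` preserves `I_v(s, χ_v)`).
FILE T2 (`localIntertwining` rescaling) and FILE T3 (the Δ-model Weil side) follow.

HONEST LABEL: HC_CM is proved only modulo the 7 printed citations (2 remaining named inputs: hLiu418 = stmt-HodgeConjecture-24832, h413 = stmt-HodgeConjecture-24833)
until rung 0 closes; this file defines one automorphism family and closes no item.
References: [Kudla1994] §3; [HarrisKudlaSweet1996] §1 (1.11), (1.15); [MoeglinVignerasWaldspurger1987] Chap. 1 I.17 (similitudes normalise the isometry group);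
[PlatonovRapinchuk1994] §2.3.
-/

set_option autoImplicit false
set_option linter.dupNamespace false -- the mandated namespace repeats `HodgeConjecture.HodgeConjecture`

noncomputable section

open scoped Matrix
open NumberField IsDedekindDomain Matrix Topology
open Literature.NumberTheory.Automorphic Literature.NumberTheory.Automorphic.UnitaryGroup
open Literature.NumberTheory.GelbartRogawski1991
open Literature.NumberTheory.GelbartRogawski1991.UnitaryDualPair
open Literature.NumberTheory.GelbartRogawski1991.UnitaryDualPair.LocalSplitting
open Literature.NumberTheory.GelbartRogawski1991.AdaptedBlocks
open Literature.NumberTheory.K2Lit.SiegelDoubled Literature.NumberTheory.K2Lit.LocalSiegelDoubled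

namespace Summit.HodgeConjecture.HodgeConjecture.Cruxes.HLiu418.K2LiuDeltaSimilitudeGroup

/-! ## §1 The similitude matrices -/

section Matrices

variable {S : Type*} [CommRing S] [Invertible (2 : S)] {ι : Type*} [Fintype ι] [DecidableEq ι] (σ : S →+* S)

/-- `d_a` in the adapted frame `(Δ, ∇)`: `diag(1, a·1)`. [cite: Kudla1994, §3] -/
def similY (ι : Type*) [Fintype ι] [DecidableEq ι] (a : S) : Matrix (ι ⊕ ι) (ι ⊕ ι) S :=
  Matrix.fromBlocks 1 0 0 (a • (1 : Matrix ι ι S))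

/-- `d_a` in the matrix frame `(𝕍, −𝕍)`: `R · diag(1, a·1) · R⁻¹`. [cite: HarrisKudlaSweet1996, §1 (1.11)] -/
def similMat (ι : Type*) [Fintype ι] [DecidableEq ι] (a : S) : Matrix (ι ⊕ ι) (ι ⊕ ι) S :=
  cayR S ι * similY ι a * cayRinv S ι

omit [Invertible (2 : S)] in
/-- `d_a d_b = d_{ab}` (adapted frame). [cite: Kudla1994, §3] -/
theorem similY_mul (a b : S) : similY ι a * similY ι b = similY ι (a * b) := by
  rw [similY, similY, similY, Matrix.fromBlocks_multiply]
  simp only [Matrix.mul_zero, Matrix.zero_mul, add_zero, zero_add, Matrix.mul_one, Matrix.smul_mul, Matrix.one_mul, smul_smul]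

omit [Invertible (2 : S)] in
/-- `d_1 = 1` (adapted frame). [cite: Kudla1994, §3] -/
theorem similY_one : similY ι (1 : S) = 1 := by
  rw [similY, one_smul, Matrix.fromBlocks_one]

omit [Invertible (2 : S)] in
/-- `det d_a = a^{|ι|}`. [cite: Kudla1994, §3] -/
theorem det_similY (a : S) : (similY ι a).det = a ^ Fintype.card ι := by
  rw [similY, Matrix.det_fromBlocks_zero₂₁, Matrix.det_one, one_mul, Matrix.det_smul, Matrix.det_one, mul_one]

/-- `d_a d_b = d_{ab}` (matrix frame). [cite: Kudla1994, §3] -/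
theorem similMat_mul (a b : S) : similMat ι a * similMat ι b = similMat ι (a * b) := by
  rw [similMat, similMat, similMat, ← similY_mul]
  simp only [Matrix.mul_assoc]
  rw [← Matrix.mul_assoc (cayRinv S ι) (cayR S ι), cayRinv_mul_cayR, Matrix.one_mul]

/-- `d_1 = 1` (matrix frame). [cite: Kudla1994, §3] -/
theorem similMat_one : similMat ι (1 : S) = 1 := by
  rw [similMat, similY_one, Matrix.mul_one, cayR_mul_cayRinv]

/-- `det d_a = a^{|ι|}` (matrix frame). [cite: Kudla1994, §3] -/
theorem det_similMat (a : S) : (similMat ι a).det = a ^ Fintype.card ι := by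
  rw [similMat, Matrix.det_mul, Matrix.det_mul, mul_comm (cayR S ι).det, mul_assoc, ← Matrix.det_mul, cayR_mul_cayRinv,
    Matrix.det_one, mul_one, det_similY]

/-- the adapted form of `similMat a` is `similY a`. [cite: HarrisKudlaSweet1996, §1 (1.11)] -/
theorem adapt_similMat (a : S) : adapt (similMat ι a) = similY ι a :=
  adapt_conj _

omit [Fintype ι] [Invertible (2 : S)] in
/-- `Rᴴ = R`. [cite: HarrisKudlaSweet1996, §1 (1.11)] -/
theorem cstar_cayR : ((cayR S ι).map σ)ᵀ = cayR S ι := by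
  rw [cayR, Matrix.fromBlocks_map, Matrix.fromBlocks_transpose, Matrix.map_neg _ (map_neg σ),
    Matrix.map_one σ (map_zero σ) (map_one σ), Matrix.transpose_neg, Matrix.transpose_one]

omit [Fintype ι] [DecidableEq ι] in
/-- `σ(⅟2) = ⅟2`. [folklore] -/
theorem map_invOf_two : σ (⅟(2 : S)) = ⅟(2 : S) := by
  have h2 : σ (2 : S) = 2 := map_ofNat σ 2
  have h : σ (2 : S) * σ ⅟(2 : S) = 1 := by rw [← map_mul, mul_invOf_self, map_one]
  rw [h2] at h
  exact (invOf_eq_right_inv h).symm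

omit [Fintype ι] in
/-- `(R⁻¹)ᴴ = R⁻¹`. [cite: HarrisKudlaSweet1996, §1 (1.11)] -/
theorem cstar_cayRinv : ((cayRinv S ι).map σ)ᵀ = cayRinv S ι := by
  rw [cayRinv]
  have : ((⅟(2 : S) • cayR S ι).map σ) = ⅟(2 : S) • (cayR S ι).map σ := by
    ext i j
    simp only [Matrix.map_apply, Matrix.smul_apply, smul_eq_mul, map_mul, map_invOf_two]
  rw [this, Matrix.transpose_smul, cstar_cayR]

omit [Invertible (2 : S)] in
/-- `R (T ⊕ −T) R = antidiag(2T, 2T)`. [cite: HarrisKudlaSweet1996, §1 (1.11)] -/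
theorem cayR_mul_diag_mul_cayR (T : Matrix ι ι S) :
    cayR S ι * Matrix.fromBlocks T 0 0 (-T) * cayR S ι = Matrix.fromBlocks 0 ((2 : S) • T) ((2 : S) • T) 0 := by
  rw [cayR, Matrix.fromBlocks_multiply, Matrix.fromBlocks_multiply, two_smul]
  simp only [Matrix.one_mul, Matrix.mul_one, Matrix.mul_zero, add_zero, zero_add, Matrix.mul_neg, Matrix.neg_mul, neg_neg]
  congr 1 <;> abel

omit [Invertible (2 : S)] in
/-- `d_aᴴ = d_a` in the adapted frame, for `σ a = a`. [cite: Kudla1994, §3] -/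
theorem cstar_similY {a : S} (ha : σ a = a) : ((similY ι a).map σ)ᵀ = similY ι a := by
  have h1 : ((a • (1 : Matrix ι ι S)).map σ) = a • (1 : Matrix ι ι S) := by
    ext i j
    simp only [Matrix.map_apply, Matrix.smul_apply, smul_eq_mul, map_mul, ha, Matrix.one_apply]
    split_ifs <;> simp
  rw [similY, Matrix.fromBlocks_map, Matrix.fromBlocks_transpose, Matrix.map_one σ (map_zero σ) (map_one σ), Matrix.map_zero σ (map_zero σ), h1,
    Matrix.transpose_one, Matrix.transpose_zero, Matrix.transpose_smul, Matrix.transpose_one]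

omit [Invertible (2 : S)] in
/-- **`d_a` IS A SIMILITUDE OF `antidiag(2T, 2T)` WITH MULTIPLIER `a`** (adapted frame). [cite: Kudla1994, §3] [cite: MoeglinVignerasWaldspurger1987, Chap. 1 I.17] -/
theorem cstar_similY_mul_antidiag_mul {a : S} (ha : σ a = a) (T : Matrix ι ι S) :
    ((similY ι a).map σ)ᵀ * Matrix.fromBlocks 0 ((2 : S) • T) ((2 : S) • T) 0 * similY ι a = a • Matrix.fromBlocks 0 ((2 : S) • T) ((2 : S) • T) 0 := by
  rw [cstar_similY σ ha, similY, Matrix.fromBlocks_multiply, Matrix.fromBlocks_multiply, Matrix.fromBlocks_smul]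
  simp only [Matrix.one_mul, Matrix.mul_one, Matrix.mul_zero, Matrix.zero_mul, add_zero, zero_add, Matrix.smul_mul, Matrix.mul_smul, smul_zero]
  rw [smul_comm (2 : S) a T]

/-- **`d_a` IS A SIMILITUDE OF `T ⊕ −T` WITH MULTIPLIER `a`** (matrix frame). [cite: Kudla1994, §3] [cite: MoeglinVignerasWaldspurger1987, Chap. 1 I.17] -/
theorem cstar_similMat_mul_diag_mul {a : S} (ha : σ a = a) (T : Matrix ι ι S) :
    ((similMat ι a).map σ)ᵀ * Matrix.fromBlocks T 0 0 (-T) * similMat ι a = a • Matrix.fromBlocks T 0 0 (-T) := by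
  have hst : ((similMat ι a).map σ)ᵀ = cayRinv S ι * ((similY ι a).map σ)ᵀ * cayR S ι := by
    rw [similMat, Matrix.map_mul, Matrix.map_mul, Matrix.transpose_mul, Matrix.transpose_mul, cstar_cayR σ, cstar_cayRinv σ, Matrix.mul_assoc]
  have hJ : Matrix.fromBlocks T 0 0 (-T) = cayRinv S ι * Matrix.fromBlocks 0 ((2 : S) • T) ((2 : S) • T) 0 * cayRinv S ι := by
    rw [← cayR_mul_diag_mul_cayR, ← Matrix.mul_assoc, ← Matrix.mul_assoc, cayRinv_mul_cayR, Matrix.one_mul, Matrix.mul_assoc, cayR_mul_cayRinv, Matrix.mul_one]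
  rw [hst, hJ, similMat]
  calc cayRinv S ι * ((similY ι a).map σ)ᵀ * cayR S ι * (cayRinv S ι * Matrix.fromBlocks 0 ((2 : S) • T) ((2 : S) • T) 0 * cayRinv S ι) *
        (cayR S ι * similY ι a * cayRinv S ι)
      = cayRinv S ι * ((similY ι a).map σ)ᵀ * (cayR S ι * cayRinv S ι) * Matrix.fromBlocks 0 ((2 : S) • T) ((2 : S) • T) 0 *
          (cayRinv S ι * cayR S ι) * similY ι a * cayRinv S ι := by simp only [Matrix.mul_assoc]
    _ = cayRinv S ι * (((similY ι a).map σ)ᵀ * Matrix.fromBlocks 0 ((2 : S) • T) ((2 : S) • T) 0 * similY ι a) * cayRinv S ι := by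
          rw [cayRinv_mul_cayR, cayR_mul_cayRinv, Matrix.mul_one, Matrix.mul_one]; simp only [Matrix.mul_assoc]
    _ = a • (cayRinv S ι * Matrix.fromBlocks 0 ((2 : S) • T) ((2 : S) • T) 0 * cayRinv S ι) := by
          rw [cstar_similY_mul_antidiag_mul σ ha, Matrix.mul_smul, Matrix.smul_mul]

omit [Invertible (2 : S)] in
/-- the block action of `d_a (·) d_{a′}` in the adapted frame: `A ↦ A`, `B ↦ a′B`, `C ↦ aC`, `D ↦ (a a′) D`. [cite: Kudla1994, §3] -/
theorem similY_mul_fromBlocks_mul_similY (a a' : S) (A B C D : Matrix ι ι S) :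
    similY ι a * Matrix.fromBlocks A B C D * similY ι a' = Matrix.fromBlocks A (a' • B) (a • C) ((a * a') • D) := by
  rw [similY, similY, Matrix.fromBlocks_multiply, Matrix.fromBlocks_multiply]
  simp only [Matrix.one_mul, Matrix.mul_one, Matrix.mul_zero, Matrix.zero_mul, add_zero, zero_add, Matrix.smul_mul, Matrix.mul_smul, smul_smul, mul_comm a' a]

end Matrices

/-! ## §2 `Ad d_a` on `H_v` -/

section Ad

variable (F : Type) [Field F] [NumberField F] (E : Type) [Field E] [NumberField E] [Algebra F E] (c : E ≃ₐ[F] E)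
  (v : HeightOneSpectrum (𝓞 F)) (n : ℕ) {T₀ : Matrix (Fin n) (Fin n) F}
  {JD : Matrix (Fin (n + n)) (Fin (n + n)) E} (hJD : JD = (gramD F n T₀).map (algebraMap F E))

/-- **`d_a ∈ GL_{2n}(E ⊗ F_v)`** for `a ∈ (F_v)ˣ` (matrix frame, `e₂`-enumerated). [cite: Kudla1994, §3] -/
def similGL (a : (v.adicCompletion F)ˣ) : GL (Fin (n + n)) (LocalRing E v) :=
  Matrix.GeneralLinearGroup.mk'' (Matrix.reindex (e₂ n) (e₂ n) (similMat (Fin n) (toLocalRing E v (a : v.adicCompletion F))))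
    (by
      rw [Matrix.det_reindex_self, det_similMat, ← map_pow]
      exact (a.isUnit.pow _).map _)

/-- the matrix of `similGL a`. [cite: Kudla1994, §3] -/
theorem coe_similGL (a : (v.adicCompletion F)ˣ) :
    (similGL F E v n a).val = Matrix.reindex (e₂ n) (e₂ n) (similMat (Fin n) (toLocalRing E v (a : v.adicCompletion F))) :=
  rfl

/-- `a ↦ d_a` is multiplicative. [cite: Kudla1994, §3] -/
theorem similGL_mul (a b : (v.adicCompletion F)ˣ) : similGL F E v n a * similGL F E v n b = similGL F E v n (a * b) := by
  apply Units.ext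
  rw [Units.val_mul, coe_similGL, coe_similGL, coe_similGL, Matrix.reindex_apply, Matrix.reindex_apply, Matrix.reindex_apply,
    Matrix.submatrix_mul_equiv, similMat_mul, Units.val_mul, map_mul]

/-- `d_1 = 1`. [cite: Kudla1994, §3] -/
theorem similGL_one : similGL F E v n 1 = 1 := by
  apply Units.ext
  rw [coe_similGL, Units.val_one, map_one, similMat_one, Matrix.reindex_apply, Matrix.submatrix_one_equiv, Units.val_one]

/-- `d_a⁻¹ = d_{a⁻¹}`. [cite: Kudla1994, §3] -/
theorem similGL_inv (a : (v.adicCompletion F)ˣ) : (similGL F E v n a)⁻¹ = similGL F E v n a⁻¹ :=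
  inv_eq_of_mul_eq_one_right (by rw [similGL_mul, mul_inv_cancel, similGL_one])

include hJD in
/-- **`d_a` IS A LOCAL SIMILITUDE OF `J^𝔻` WITH MULTIPLIER `a`**: `ᵗ((c ⊗ 1) d_a) · J^𝔻_v · d_a = a • J^𝔻_v` (★ `localFormD_eq`: `J^𝔻_v = T₀ ⊕ −T₀` reindexed).
[cite: Kudla1994, §3] [cite: MoeglinVignerasWaldspurger1987, Chap. 1 I.17] -/
theorem formCongr_similGL (a : (v.adicCompletion F)ˣ) :
    Literature.NumberTheory.Automorphic.formCongr (conjLocal E c v) (similGL F E v n a) (JD.map (algebraMap E (LocalRing E v))) =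
      toLocalRing E v (a : v.adicCompletion F) • JD.map (algebraMap E (LocalRing E v)) := by
  rw [← adelicForm_map_adeleToLocal, localFormD_eq F E v n hJD, Literature.NumberTheory.Automorphic.formCongr, coe_similGL]
  have ht : ((Matrix.reindex (e₂ n) (e₂ n) (similMat (Fin n) (toLocalRing E v (a : v.adicCompletion F)))).map (conjLocal E c v))ᵀ =
      Matrix.reindex (e₂ n) (e₂ n) (((similMat (Fin n) (toLocalRing E v (a : v.adicCompletion F))).map (conjLocal E c v))ᵀ) := by
    rw [Matrix.reindex_apply, Matrix.reindex_apply, ← Matrix.submatrix_map, Matrix.transpose_submatrix]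
  rw [ht, Matrix.reindex_apply, Matrix.reindex_apply, Matrix.reindex_apply, Matrix.submatrix_mul_equiv, Matrix.submatrix_mul_equiv,
    cstar_similMat_mul_diag_mul (conjLocal E c v) (conjLocal_toLocalRing c v (a : v.adicCompletion F)), Matrix.submatrix_smul]
  rfl

include hJD in
/-- **`Ad d_a : H_v ≃ₜ* H_v`, `g ↦ d_a g d_a⁻¹`** — conjugation by the `Δ`-similitude, transported to the `Π_w GL(E_w)` model (★ `localPiEquiv`, ★ `localFormCongr`).
[cite: MoeglinVignerasWaldspurger1987, Chap. 1 I.17] [cite: PlatonovRapinchuk1994, §2.3] -/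
def adDeltaSimil (a : (v.adicCompletion F)ˣ) : UnitaryGroup.localPi E c (n + n) JD v ≃ₜ* UnitaryGroup.localPi E c (n + n) JD v :=
  (localPiEquiv E c (n + n) JD v).trans
    ((localFormCongr c v (similGL F E v n a) ((a.isUnit).map (toLocalRing E v)) (formCongr_similGL F E c v n hJD a)).trans
      (localPiEquiv E c (n + n) JD v).symm)

include hJD in
/-- the matrix of `Ad d_a g` over `E ⊗ F_v`: `d_a · g · d_a⁻¹`. [cite: Kudla1994, §3] -/
theorem matS_adDeltaSimil (a : (v.adicCompletion F)ˣ) (g : UnitaryGroup.localPi E c (n + n) JD v) :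
    matS F E c v n (adDeltaSimil F E c v n hJD a g) =
      Matrix.reindex (e₂ n) (e₂ n) (similMat (Fin n) (toLocalRing E v (a : v.adicCompletion F))) * matS F E c v n g *
        Matrix.reindex (e₂ n) (e₂ n) (similMat (Fin n) (toLocalRing E v ((a⁻¹ : (v.adicCompletion F)ˣ) : v.adicCompletion F))) := by
  rw [matS, adDeltaSimil, ContinuousMulEquiv.trans_apply, ContinuousMulEquiv.trans_apply, ContinuousMulEquiv.apply_symm_apply,
    coe_localFormCongr_apply, similGL_inv, Units.val_mul, Units.val_mul, coe_similGL, coe_similGL]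

include hJD in
/-- **the adapted-frame matrix of `Ad d_a g`**: `matA (Ad d_a g) = d_a · matA g · d_{a⁻¹}`. [cite: Kudla1994, §3] -/
theorem matA_adDeltaSimil (a : (v.adicCompletion F)ˣ) (g : UnitaryGroup.localPi E c (n + n) JD v) :
    matA F E c v n (adDeltaSimil F E c v n hJD a g) =
      similMat (Fin n) (toLocalRing E v (a : v.adicCompletion F)) * matA F E c v n g *
        similMat (Fin n) (toLocalRing E v ((a⁻¹ : (v.adicCompletion F)ˣ) : v.adicCompletion F)) := by
  rw [matA, matA, matS_adDeltaSimil]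
  simp only [Matrix.reindex_apply, Equiv.symm_symm]
  rw [← Matrix.submatrix_mul_equiv _ _ _ (e₂ n) _, ← Matrix.submatrix_mul_equiv _ _ _ (e₂ n) _, Matrix.submatrix_submatrix, Matrix.submatrix_submatrix,
    Equiv.symm_comp_self, Matrix.submatrix_id_id, Matrix.submatrix_id_id]

include hJD in
/-- in the adapted frame: `adapt (matA (Ad d_a g)) = diag(1,a) · adapt (matA g) · diag(1,a⁻¹)`. [cite: Kudla1994, §3] -/
theorem adapt_matA_adDeltaSimil (a : (v.adicCompletion F)ˣ) (g : UnitaryGroup.localPi E c (n + n) JD v) :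
    adapt (matA F E c v n (adDeltaSimil F E c v n hJD a g)) =
      Matrix.fromBlocks (blkA (matA F E c v n g)) (toLocalRing E v ((a⁻¹ : (v.adicCompletion F)ˣ) : v.adicCompletion F) • blkB (matA F E c v n g))
        (toLocalRing E v (a : v.adicCompletion F) • blkC (matA F E c v n g)) (blkD (matA F E c v n g)) := by
  rw [matA_adDeltaSimil, adapt_mul, adapt_mul, adapt_similMat, adapt_similMat, adapt_eq, similY_mul_fromBlocks_mul_similY, ← map_mul,
    ← Units.val_mul, mul_inv_cancel, Units.val_one, map_one, one_smul]

include hJD in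
/-- **THE BLOCK ACTION OF `Ad d_a`**: `A ↦ A`. [cite: Kudla1994, §3] -/
theorem blkA_matA_adDeltaSimil (a : (v.adicCompletion F)ˣ) (g : UnitaryGroup.localPi E c (n + n) JD v) :
    blkA (matA F E c v n (adDeltaSimil F E c v n hJD a g)) = blkA (matA F E c v n g) :=
  (Matrix.fromBlocks_inj.1 ((adapt_eq _).symm.trans (adapt_matA_adDeltaSimil F E c v n hJD a g))).1

include hJD in
/-- `B ↦ a⁻¹ B`. [cite: Kudla1994, §3] -/
theorem blkB_matA_adDeltaSimil (a : (v.adicCompletion F)ˣ) (g : UnitaryGroup.localPi E c (n + n) JD v) :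
    blkB (matA F E c v n (adDeltaSimil F E c v n hJD a g)) = toLocalRing E v ((a⁻¹ : (v.adicCompletion F)ˣ) : v.adicCompletion F) • blkB (matA F E c v n g) :=
  (Matrix.fromBlocks_inj.1 ((adapt_eq _).symm.trans (adapt_matA_adDeltaSimil F E c v n hJD a g))).2.1

include hJD in
/-- `C ↦ a C`. [cite: Kudla1994, §3] -/
theorem blkC_matA_adDeltaSimil (a : (v.adicCompletion F)ˣ) (g : UnitaryGroup.localPi E c (n + n) JD v) :
    blkC (matA F E c v n (adDeltaSimil F E c v n hJD a g)) = toLocalRing E v (a : v.adicCompletion F) • blkC (matA F E c v n g) :=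
  (Matrix.fromBlocks_inj.1 ((adapt_eq _).symm.trans (adapt_matA_adDeltaSimil F E c v n hJD a g))).2.2.1

include hJD in
/-- `D ↦ D`. [cite: Kudla1994, §3] -/
theorem blkD_matA_adDeltaSimil (a : (v.adicCompletion F)ˣ) (g : UnitaryGroup.localPi E c (n + n) JD v) :
    blkD (matA F E c v n (adDeltaSimil F E c v n hJD a g)) = blkD (matA F E c v n g) :=
  (Matrix.fromBlocks_inj.1 ((adapt_eq _).symm.trans (adapt_matA_adDeltaSimil F E c v n hJD a g))).2.2.2

end Ad

/-! ## §3 Invariances: the Siegel parabolic, its character, `I_v(s, χ_v)` -/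

section Invariances

variable (F : Type) [Field F] [NumberField F] (E : Type) [Field E] [NumberField E] [Algebra F E]
  [Algebra.IsQuadraticExtension F E] (c : E ≃ₐ[F] E)
  {δ : E} (hcδ : c δ = -δ) (hδ : δ ≠ 0) {d : F} (hd : δ * δ = algebraMap F E d)
  (v : HeightOneSpectrum (𝓞 F)) (n : ℕ) {T₀ : Matrix (Fin n) (Fin n) F} (hT₀ : T₀.IsSymm)
  {JD : Matrix (Fin (n + n)) (Fin (n + n)) E} (hJD : JD = (gramD F n T₀).map (algebraMap F E))

include hcδ hδ hd hT₀ in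
/-- **`Ad d_a` PRESERVES `P_Δ(F_v)`** (`C ↦ a C`). [cite: Kudla1994, §3] [cite: HarrisKudlaSweet1996, §1 (1.11)] -/
theorem isSiegelDelta_adDeltaSimil_iff (a : (v.adicCompletion F)ˣ) (g : UnitaryGroup.localPi E c (n + n) JD v) :
    IsSiegelDelta F E c hcδ hδ hd v n hT₀ hJD (adDeltaSimil F E c v n hJD a g) ↔ IsSiegelDelta F E c hcδ hδ hd v n hT₀ hJD g := by
  rw [isSiegelDelta_iff_blkC_eq_zero F E c hcδ hδ hd v n hT₀ hJD, isSiegelDelta_iff_blkC_eq_zero F E c hcδ hδ hd v n hT₀ hJD,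
    blkC_matA_adDeltaSimil, ((a.isUnit).map (toLocalRing E v)).smul_eq_zero]

omit [Algebra.IsQuadraticExtension F E] in
include hJD in
/-- **`Ad d_a` PRESERVES `N_Δ(F_v)`** (`A, D` fixed, `C ↦ a C`). [cite: Kudla1994, §3] -/
theorem adDeltaSimil_mem_unipDeltaLocal_iff (a : (v.adicCompletion F)ˣ) (g : UnitaryGroup.localPi E c (n + n) JD v) :
    adDeltaSimil F E c v n hJD a g ∈ unipDeltaLocal F E c v n (JD := JD) ↔ g ∈ unipDeltaLocal F E c v n (JD := JD) := by
  rw [mem_unipDeltaLocal_iff_blocks, mem_unipDeltaLocal_iff_blocks, blkC_matA_adDeltaSimil, blkA_matA_adDeltaSimil, blkD_matA_adDeltaSimil,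
    ((a.isUnit).map (toLocalRing E v)).smul_eq_zero]

include hcδ hδ hd hT₀ in
/-- **`det_Δ (Ad d_a p) = det_Δ p` on `P_Δ(F_v)`** (`A ↦ A`; ★ `detDelta_eq_det_blkA`, ★ `matW_eq_matA_map`). [cite: Kudla1994, §3] [cite: HarrisKudlaSweet1996, §1 (1.15)] -/
theorem detDelta_adDeltaSimil {p : UnitaryGroup.localPi E c (n + n) JD v} (hp : IsSiegelDelta F E c hcδ hδ hd v n hT₀ hJD p)
    (a : (v.adicCompletion F)ˣ) (w : PlacesOver E v) :
    detDelta F E c v n w (adDeltaSimil F E c v n hJD a p) = detDelta F E c v n w p := by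
  rw [detDelta_eq_det_blkA F E c hcδ hδ hd v n hT₀ hJD ((isSiegelDelta_adDeltaSimil_iff F E c hcδ hδ hd v n hT₀ hJD a p).2 hp) w,
    detDelta_eq_det_blkA F E c hcδ hδ hd v n hT₀ hJD hp w, matW_eq_matA_map, matW_eq_matA_map, blkA_map, blkA_map, blkA_matA_adDeltaSimil]

include hcδ hδ hd hT₀ in
/-- `|det_Δ (Ad d_a p)|_v = |det_Δ p|_v` on `P_Δ(F_v)`. [cite: HarrisKudlaSweet1996, §1 (1.15)] -/
theorem absDetDelta_adDeltaSimil {p : UnitaryGroup.localPi E c (n + n) JD v} (hp : IsSiegelDelta F E c hcδ hδ hd v n hT₀ hJD p)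
    (a : (v.adicCompletion F)ˣ) : absDetDelta F E c v n (adDeltaSimil F E c v n hJD a p) = absDetDelta F E c v n p :=
  Finset.prod_congr rfl fun w _ => by rw [detDelta_adDeltaSimil F E c hcδ hδ hd v n hT₀ hJD hp]

include hcδ hδ hd hT₀ in
/-- `χ_v(det_Δ (Ad d_a p)) = χ_v(det_Δ p)` on `P_Δ(F_v)`. [cite: HarrisKudlaSweet1996, §1 (1.15)] -/
theorem chiDet_adDeltaSimil {p : UnitaryGroup.localPi E c (n + n) JD v} (hp : IsSiegelDelta F E c hcδ hδ hd v n hT₀ hJD p)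
    (a : (v.adicCompletion F)ˣ) (χv : ∀ w : PlacesOver E v, (w.1.adicCompletion E)ˣ →* ℂˣ) :
    chiDet F E c v n χv (adDeltaSimil F E c v n hJD a p) = chiDet F E c v n χv p := by
  unfold chiDet
  refine Finset.prod_congr rfl fun w _ => ?_
  have h := detDelta_adDeltaSimil F E c hcδ hδ hd v n hT₀ hJD hp a w
  by_cases hu : IsUnit (detDelta F E c v n w p)
  · have hu' : IsUnit (detDelta F E c v n w (adDeltaSimil F E c v n hJD a p)) := by rw [h]; exact hu
    rw [dif_pos hu', dif_pos hu]
    congr 1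
    exact Units.ext (by simp only [IsUnit.unit_spec, h])
  · have hu' : ¬IsUnit (detDelta F E c v n w (adDeltaSimil F E c v n hJD a p)) := by rw [h]; exact hu
    rw [dif_neg hu', dif_neg hu]

include hcδ hδ hd hT₀ in
/-- **THE SIEGEL CHARACTER IS `Ad d_a`-INVARIANT ON `P_Δ(F_v)`**. [cite: HarrisKudlaSweet1996, §1 (1.15)] -/
theorem localSiegelCharacter_adDeltaSimil {p : UnitaryGroup.localPi E c (n + n) JD v} (hp : IsSiegelDelta F E c hcδ hδ hd v n hT₀ hJD p)
    (a : (v.adicCompletion F)ˣ) (χv : ∀ w : PlacesOver E v, (w.1.adicCompletion E)ˣ →* ℂˣ) (s : ℂ) :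
    localSiegelCharacter F E c v n χv s (adDeltaSimil F E c v n hJD a p) = localSiegelCharacter F E c v n χv s p := by
  unfold localSiegelCharacter
  rw [chiDet_adDeltaSimil F E c hcδ hδ hd v n hT₀ hJD hp, absDetDelta_adDeltaSimil F E c hcδ hδ hd v n hT₀ hJD hp]

include hcδ hδ hd hT₀ in
/-- **`f ↦ f ∘ Ad d_a` PRESERVES SIEGEL SECTIONS** of `I_v(s, χ_v)`. [cite: HarrisKudlaSweet1996, §1 (1.15)] [cite: MoeglinVignerasWaldspurger1987, Chap. 1 I.17] -/
theorem isLocalSiegelSection_comp_adDeltaSimil (a : (v.adicCompletion F)ˣ) (χv : ∀ w : PlacesOver E v, (w.1.adicCompletion E)ˣ →* ℂˣ) (s : ℂ)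
    {f : UnitaryGroup.localPi E c (n + n) JD v → ℂ} (hf : IsLocalSiegelSection F E c hcδ hδ hd v n hT₀ hJD χv s f) :
    IsLocalSiegelSection F E c hcδ hδ hd v n hT₀ hJD χv s (f ∘ adDeltaSimil F E c v n hJD a) := fun p hp h => by
  simp only [Function.comp_apply, map_mul]
  rw [hf _ ((isSiegelDelta_adDeltaSimil_iff F E c hcδ hδ hd v n hT₀ hJD a p).2 hp), localSiegelCharacter_adDeltaSimil F E c hcδ hδ hd v n hT₀ hJD hp]

omit [Algebra.IsQuadraticExtension F E] in
include hJD in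
/-- **`f ↦ f ∘ Ad d_a` PRESERVES SMOOTHNESS** (the level `U` becomes `(Ad d_a)⁻¹ U`). [cite: BernsteinZelevinsky1976, §1] [cite: HarrisKudlaSweet1996, §1] -/
theorem isSmooth_comp_adDeltaSimil (a : (v.adicCompletion F)ˣ) {f : UnitaryGroup.localPi E c (n + n) JD v → ℂ} (hf : IsSmooth F E c v n f) :
    IsSmooth F E c v n (f ∘ adDeltaSimil F E c v n hJD a) := by
  obtain ⟨U, hU⟩ := hf
  refine ⟨U.comap (adDeltaSimil F E c v n hJD a).toMulEquiv.toMonoidHom (adDeltaSimil F E c v n hJD a).continuous, fun h u hu => ?_⟩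
  simp only [Function.comp_apply, map_mul]
  exact hU _ _ hu

include hcδ hδ hd hT₀ in
/-- **`f ↦ f ∘ Ad d_a` MAPS `I_v(s, χ_v)` TO ITSELF.** [cite: HarrisKudlaSweet1996, §1 (1.15)] [cite: MoeglinVignerasWaldspurger1987, Chap. 1 I.17] -/
theorem comp_adDeltaSimil_mem_localDegPS (a : (v.adicCompletion F)ˣ) (χv : ∀ w : PlacesOver E v, (w.1.adicCompletion E)ˣ →* ℂˣ) (s : ℂ)
    {f : UnitaryGroup.localPi E c (n + n) JD v → ℂ} (hf : f ∈ localDegPS F E c hcδ hδ hd v n hT₀ hJD χv s) :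
    f ∘ adDeltaSimil F E c v n hJD a ∈ localDegPS F E c hcδ hδ hd v n hT₀ hJD χv s :=
  ⟨isLocalSiegelSection_comp_adDeltaSimil F E c hcδ hδ hd v n hT₀ hJD a χv s hf.1, isSmooth_comp_adDeltaSimil F E c v n hJD a hf.2⟩

end Invariances

end Summit.HodgeConjecture.HodgeConjecture.Cruxes.HLiu418.K2LiuDeltaSimilitudeGroup

end
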